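import Literature.MathematicalPhysics.QuantumLattice.DWaveSourceTorusJointPressure
import HarnessLib

/-!
# The sourced torus pressure as a power series in the source, with interaction-dependent coefficients

Topic `MathematicalPhysics/QuantumLattice`; continuation of `DWaveSourceTorusJointExpansion` /
`DWaveSourceTorusJointPressure` (fixed temperature). There, for `β ≥ 0`, `μ` and `L ≥ 3`, the partition
function of the `d`-wave–sourced Hubbard torus is `Z_L(U,h) = e^{βμL²} Z₀(L) exp(Σ_{j≥1} c_j(L;U,h))` with the
homogeneous polynomials `c_j = Σ_{m≤j} C_{j,m}(L) U^{j-m} h^m`, `‖C_{j,m}‖ ≤ L²Aϱ^j`, for real `|U|, |h| ≤ δ`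
(`ϱδ ≤ 1/3`). This file REARRANGES the absolutely convergent double series by powers of the source:

`Σ_{j≥1} c_j(L;U,h) = Σ_{m≥0} a_m(L;U) h^m`,  `a_m(L;U) = Σ_{j ≥ max(m,1)} C_{j,m}(L) U^{j-m}`,

with the bounds (uniform in `L` apart from the factor `L²`, and in `|U| ≤ δ`)

* `‖a_m(L;U)‖ ≤ (3/2) L² A ϱ^m` — the source power series has radius `≥ 1/ϱ = 3δ`;
* `‖a_m(L;U) - a_m(L;0)‖ ≤ (3/2) L² A ϱ^{m+1} |U|` — **every source Taylor coefficient of the pressure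
  (every imaginary-time-ordered cumulant of the macroscopic `d`-wave pair field) differs from its free value
  by `O(|U|)`**, uniformly in the volume;

and the representation `Z_L(U,h) = Z₀'(L) · exp(Σ_m a_m(L;U) h^m)` with a positive real `Z₀'(L)`
(`dWaveSourceTorus_partitionFn_eq_exp_sourcePowerSeries`). The abstract rearrangement (any array `C_{j,m}` with
geometric bounds) is `tsum_connected_eq_tsum_sourceCoeff_mul_pow`. This is the input of the complex-source
continuation (zero-free source disc and the Taylor coefficients `(m!)⁻¹(log Z_L)⁽ᵐ⁾(0) = a_m`) and of the
fixed-temperature susceptibility comparison. Everything is PROVED; no definition and no named fact.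

## References
* G. Benfatto, A. Giuliani, V. Mastropietro, Ann. Henri Poincaré 7 (2006) 809–898, §2, (2.77).
  [cite: BenfattoGiulianiMastropietro2006, (2.77)]
* D. Ruelle, *Statistical Mechanics: Rigorous Results* (1969), §4.4. [cite: Ruelle1969, §4.4]
-/

noncomputable section

open scoped Matrix.Norms.L2Operator ComplexOrder
open Finset MeasureTheory Filter Topology NormedSpace Set
open Literature.Probability.LatticeModels

namespace Literature.MathematicalPhysics.QuantumLattice

/-! ### Rearranging a geometrically bounded double series by powers of the second variable -/

section Rearrangement

variable {C : ℕ → ℕ → ℂ} {B ϱ δ : ℝ}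

/-- `Σ_i x^i ≤ 3/2` for `0 ≤ x ≤ 1/3`. [folklore] -/
theorem tsum_pow_le_three_halves {x : ℝ} (h0 : 0 ≤ x) (hx : x ≤ 1 / 3) : ∑' i : ℕ, x ^ i ≤ 3 / 2 := by
  have hx1 : x < 1 := by linarith
  rw [tsum_geometric_of_lt_one h0 hx1]
  rw [inv_le_comm₀ (by linarith) (by norm_num)]
  linarith

/-- Summability of `Σ_i x^i` scaled, `0 ≤ x ≤ 1/3`. [folklore] -/
theorem summable_const_mul_pow {x : ℝ} (h0 : 0 ≤ x) (hx : x ≤ 1 / 3) (c : ℝ) :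
    Summable fun i : ℕ => c * x ^ i :=
  (summable_geometric_of_lt_one h0 (by linarith)).mul_left c

/-- **The source coefficients are geometrically bounded**: with `‖C_{j,m}‖ ≤ Bϱ^j` (`j ≥ 1`), `ϱδ ≤ 1/3` and
`‖U‖ ≤ δ`, the series `a_m(U) = Σ_{j ≥ max(m,1)} C_{j,m} U^{j-m}` converges and `‖a_m(U)‖ ≤ (3/2) B ϱ^m`.
[folklore] -/
theorem norm_sourceCoeff_le (hB : 0 ≤ B) (hϱ : 0 ≤ ϱ) (hδ : 0 ≤ δ) (hϱδ : ϱ * δ ≤ 1 / 3)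
    (hC : ∀ j m : ℕ, 1 ≤ j → ‖C j m‖ ≤ B * ϱ ^ j) {U : ℂ} (hU : ‖U‖ ≤ δ) (m : ℕ) :
    (Summable fun j : ℕ => if 1 ≤ j ∧ m ≤ j then C j m * U ^ (j - m) else 0) ∧
      ‖∑' j : ℕ, (if 1 ≤ j ∧ m ≤ j then C j m * U ^ (j - m) else 0)‖ ≤ 3 / 2 * B * ϱ ^ m := by
  set t : ℕ → ℂ := fun j => if 1 ≤ j ∧ m ≤ j then C j m * U ^ (j - m) else 0 with ht
  have hϱδ0 : 0 ≤ ϱ * δ := mul_nonneg hϱ hδ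
  -- the shifted terms
  have hshift : ∀ i : ℕ, ‖t (i + m)‖ ≤ B * ϱ ^ m * (ϱ * δ) ^ i := by
    intro i
    have hnn : 0 ≤ B * ϱ ^ m * (ϱ * δ) ^ i := by positivity
    simp only [ht]
    split_ifs with h
    · rw [norm_mul, norm_pow, Nat.add_sub_cancel]
      calc ‖C (i + m) m‖ * ‖U‖ ^ i ≤ B * ϱ ^ (i + m) * δ ^ i :=
            mul_le_mul (hC _ _ h.1) (pow_le_pow_left₀ (norm_nonneg _) hU i) (by positivity) (by positivity)
        _ = B * ϱ ^ m * (ϱ * δ) ^ i := by rw [pow_add, mul_pow]; ring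
    · rw [norm_zero]; exact hnn
  have hzero : ∀ i ∈ Finset.range m, t i = 0 := by
    intro i hi
    have him : i < m := Finset.mem_range.mp hi
    simp only [ht]
    rw [if_neg]
    omega
  have hsum_shift : Summable fun i : ℕ => t (i + m) :=
    Summable.of_norm_bounded (summable_const_mul_pow hϱδ0 hϱδ (B * ϱ ^ m)) hshift
  have hsum : Summable t := (summable_nat_add_iff m).mp hsum_shift
  refine ⟨hsum, ?_⟩
  have hsplit := hsum.sum_add_tsum_nat_add m
  rw [Finset.sum_eq_zero hzero, zero_add] at hsplit
  rw [← hsplit]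
  calc ‖∑' i : ℕ, t (i + m)‖ ≤ ∑' i : ℕ, ‖t (i + m)‖ := norm_tsum_le_tsum_norm hsum_shift.norm
    _ ≤ ∑' i : ℕ, B * ϱ ^ m * (ϱ * δ) ^ i :=
        Summable.tsum_le_tsum hshift hsum_shift.norm (summable_const_mul_pow hϱδ0 hϱδ _)
    _ = B * ϱ ^ m * ∑' i : ℕ, (ϱ * δ) ^ i := tsum_mul_left
    _ ≤ B * ϱ ^ m * (3 / 2) :=
        mul_le_mul_of_nonneg_left (tsum_pow_le_three_halves hϱδ0 hϱδ) (by positivity)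
    _ = 3 / 2 * B * ϱ ^ m := by ring

/-- **The interaction correction to every source coefficient is `O(‖U‖)`**:
`‖a_m(U) - a_m(0)‖ ≤ (3/2) B ϱ^{m+1} ‖U‖` for `‖U‖ ≤ δ` (the terms `j = m` cancel, the others carry a factor
`U`). [folklore] -/
theorem norm_sourceCoeff_sub_le (hB : 0 ≤ B) (hϱ : 0 ≤ ϱ) (hδ : 0 ≤ δ) (hϱδ : ϱ * δ ≤ 1 / 3)
    (hC : ∀ j m : ℕ, 1 ≤ j → ‖C j m‖ ≤ B * ϱ ^ j) {U : ℂ} (hU : ‖U‖ ≤ δ) (m : ℕ) :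
    ‖(∑' j : ℕ, (if 1 ≤ j ∧ m ≤ j then C j m * U ^ (j - m) else 0)) -
        ∑' j : ℕ, (if 1 ≤ j ∧ m ≤ j then C j m * (0 : ℂ) ^ (j - m) else 0)‖ ≤
      3 / 2 * B * ϱ ^ (m + 1) * ‖U‖ := by
  have hϱδ0 : 0 ≤ ϱ * δ := mul_nonneg hϱ hδ
  have h0 : ‖(0 : ℂ)‖ ≤ δ := by rw [norm_zero]; exact hδ
  obtain ⟨hsU, -⟩ := norm_sourceCoeff_le hB hϱ hδ hϱδ hC hU m
  obtain ⟨hs0, -⟩ := norm_sourceCoeff_le hB hϱ hδ hϱδ hC h0 m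
  rw [← hsU.tsum_sub hs0]
  set d : ℕ → ℂ := fun j => (if 1 ≤ j ∧ m ≤ j then C j m * U ^ (j - m) else 0) -
    (if 1 ≤ j ∧ m ≤ j then C j m * (0 : ℂ) ^ (j - m) else 0) with hd
  have hsd : Summable d := hsU.sub hs0
  -- the first `m + 1` terms vanish
  have hzero : ∀ i ∈ Finset.range (m + 1), d i = 0 := by
    intro i hi
    have him : i ≤ m := Nat.lt_succ_iff.mp (Finset.mem_range.mp hi)
    simp only [hd]
    rcases lt_or_eq_of_le him with hlt | rfl
    · rw [if_neg (by omega), if_neg (by omega), sub_self]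
    · simp only [Nat.sub_self, pow_zero, sub_self]
  -- the tail carries a factor `U`
  have htail : ∀ i : ℕ, ‖d (i + (m + 1))‖ ≤ B * ϱ ^ (m + 1) * ‖U‖ * (ϱ * δ) ^ i := by
    intro i
    have h1 : 1 ≤ i + (m + 1) ∧ m ≤ i + (m + 1) := ⟨by omega, by omega⟩
    have hexp : i + (m + 1) - m = i + 1 := by omega
    simp only [hd, if_pos h1, hexp, zero_pow (Nat.succ_ne_zero i), mul_zero, sub_zero, norm_mul, norm_pow]
    calc ‖C (i + (m + 1)) m‖ * ‖U‖ ^ (i + 1) ≤ B * ϱ ^ (i + (m + 1)) * (δ ^ i * ‖U‖) := by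
          refine mul_le_mul (hC _ _ h1.1) ?_ (by positivity) (by positivity)
          rw [pow_succ]
          exact mul_le_mul_of_nonneg_right (pow_le_pow_left₀ (norm_nonneg _) hU i) (norm_nonneg _)
      _ = B * ϱ ^ (m + 1) * ‖U‖ * (ϱ * δ) ^ i := by rw [pow_add, mul_pow]; ring
  have hsum_shift : Summable fun i : ℕ => d (i + (m + 1)) := (summable_nat_add_iff (m + 1)).mpr hsd
  have hsplit := hsd.sum_add_tsum_nat_add (m + 1)
  rw [Finset.sum_eq_zero hzero, zero_add] at hsplit
  rw [← hsplit]
  calc ‖∑' i : ℕ, d (i + (m + 1))‖ ≤ ∑' i : ℕ, ‖d (i + (m + 1))‖ := norm_tsum_le_tsum_norm hsum_shift.norm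
    _ ≤ ∑' i : ℕ, B * ϱ ^ (m + 1) * ‖U‖ * (ϱ * δ) ^ i :=
        Summable.tsum_le_tsum htail hsum_shift.norm (summable_const_mul_pow hϱδ0 hϱδ _)
    _ = B * ϱ ^ (m + 1) * ‖U‖ * ∑' i : ℕ, (ϱ * δ) ^ i := tsum_mul_left
    _ ≤ B * ϱ ^ (m + 1) * ‖U‖ * (3 / 2) :=
        mul_le_mul_of_nonneg_left (tsum_pow_le_three_halves hϱδ0 hϱδ) (by positivity)
    _ = 3 / 2 * B * ϱ ^ (m + 1) * ‖U‖ := by ring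

/-- **Rearrangement by powers of the source.** With `‖C_{j,m}‖ ≤ Bϱ^j` (`j ≥ 1`), `ϱδ ≤ 1/3`, `‖U‖ ≤ δ` and
`‖z‖ ≤ δ`: `Σ_{j≥1} Σ_{m≤j} C_{j,m} U^{j-m} z^m = Σ_m a_m(U) z^m` (absolutely convergent on both sides),
`a_m(U) = Σ_{j≥max(m,1)} C_{j,m} U^{j-m}`. [folklore] -/
theorem tsum_connected_eq_tsum_sourceCoeff_mul_pow (hB : 0 ≤ B) (hϱ : 0 ≤ ϱ) (hδ : 0 ≤ δ)
    (hϱδ : ϱ * δ ≤ 1 / 3) (hC : ∀ j m : ℕ, 1 ≤ j → ‖C j m‖ ≤ B * ϱ ^ j) {U : ℂ} (hU : ‖U‖ ≤ δ)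
    {z : ℂ} (hz : ‖z‖ ≤ δ) :
    (Summable fun m : ℕ =>
        ‖(∑' j : ℕ, (if 1 ≤ j ∧ m ≤ j then C j m * U ^ (j - m) else 0)) * z ^ m‖) ∧
      (∑' j : ℕ, (if j = 0 then (0 : ℂ) else
          ∑ m ∈ Finset.range (j + 1), C j m * U ^ (j - m) * z ^ m)) =
        ∑' m : ℕ, (∑' j : ℕ, (if 1 ≤ j ∧ m ≤ j then C j m * U ^ (j - m) else 0)) * z ^ m := by
  have hϱδ0 : 0 ≤ ϱ * δ := mul_nonneg hϱ hδ
  -- absolute summability of the rearranged series from the coefficient bound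
  have hAbs : Summable fun m : ℕ =>
      ‖(∑' j : ℕ, (if 1 ≤ j ∧ m ≤ j then C j m * U ^ (j - m) else 0)) * z ^ m‖ := by
    refine Summable.of_nonneg_of_le (fun m => norm_nonneg _) (fun m => ?_)
      (summable_const_mul_pow hϱδ0 hϱδ (3 / 2 * B))
    rw [norm_mul, norm_pow]
    calc _ ≤ 3 / 2 * B * ϱ ^ m * δ ^ m :=
          mul_le_mul (norm_sourceCoeff_le hB hϱ hδ hϱδ hC hU m).2 (pow_le_pow_left₀ (norm_nonneg _) hz m)
            (by positivity) (by positivity)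
      _ = 3 / 2 * B * (ϱ * δ) ^ m := by rw [mul_pow]; ring
  refine ⟨hAbs, ?_⟩
  -- the double family and its majorant
  set f : ℕ × ℕ → ℂ := fun p =>
    if 1 ≤ p.1 ∧ p.2 ≤ p.1 then C p.1 p.2 * U ^ (p.1 - p.2) * z ^ p.2 else 0 with hf
  set F : ℕ × ℕ → ℝ := fun p => if p.2 ≤ p.1 then B * (ϱ * δ) ^ p.1 else 0 with hF
  have hF0 : 0 ≤ F := fun p => by
    simp only [hF, Pi.zero_apply]
    split_ifs <;> positivity
  have hfF : ∀ p, ‖f p‖ ≤ F p := by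
    rintro ⟨j, m⟩
    simp only [hf, hF]
    by_cases h : 1 ≤ j ∧ m ≤ j
    · rw [if_pos h, if_pos h.2, norm_mul, norm_mul, norm_pow, norm_pow]
      calc ‖C j m‖ * ‖U‖ ^ (j - m) * ‖z‖ ^ m ≤ B * ϱ ^ j * δ ^ (j - m) * δ ^ m :=
            mul_le_mul (mul_le_mul (hC j m h.1) (pow_le_pow_left₀ (norm_nonneg _) hU _) (by positivity)
              (by positivity)) (pow_le_pow_left₀ (norm_nonneg _) hz _) (by positivity) (by positivity)
        _ = B * (ϱ * δ) ^ j := by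
            rw [mul_assoc, ← pow_add, Nat.sub_add_cancel h.2, mul_pow]; ring
    · rw [if_neg h, norm_zero]
      split_ifs <;> positivity
  -- summability of the majorant: rows have finite support, row sums are `(j+1) B (ϱδ)^j`
  have hrow : ∀ j : ℕ, ∑' m : ℕ, F (j, m) = ((j : ℝ) + 1) * (B * (ϱ * δ) ^ j) := by
    intro j
    rw [tsum_eq_sum (s := Finset.range (j + 1)) (fun m hm => by
      have : ¬ m ≤ j := fun h => hm (Finset.mem_range.mpr (Nat.lt_succ_of_le h))
      simp only [hF, if_neg this])]
    have hc : ∀ m ∈ Finset.range (j + 1), F (j, m) = B * (ϱ * δ) ^ j := fun m hm => by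
      simp only [hF, if_pos (Nat.lt_succ_iff.mp (Finset.mem_range.mp hm))]
    rw [Finset.sum_congr rfl hc, Finset.sum_const, Finset.card_range, nsmul_eq_mul]
    push_cast
    ring
  have hFsum : Summable F := by
    refine (summable_prod_of_nonneg hF0).mpr ⟨fun j => ?_, ?_⟩
    · exact summable_of_ne_finset_zero (s := Finset.range (j + 1)) (fun m hm => by
        have : ¬ m ≤ j := fun h => hm (Finset.mem_range.mpr (Nat.lt_succ_of_le h))
        simp only [hF, if_neg this])
    · simp_rw [hrow]
      have h1 : Summable fun j : ℕ => (j : ℝ) ^ 1 * (ϱ * δ) ^ j :=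
        summable_pow_mul_geometric_of_norm_lt_one 1 (by rw [Real.norm_eq_abs, abs_of_nonneg hϱδ0]; linarith)
      have h2 : Summable fun j : ℕ => (ϱ * δ) ^ j := summable_geometric_of_lt_one hϱδ0 (by linarith)
      refine (((h1.add h2).mul_left B)).congr (fun j => ?_)
      ring
  have hfsum : Summable f := Summable.of_norm_bounded hFsum hfF
  -- rows of `f`: the homogeneous polynomials
  have hrowf : ∀ j : ℕ, ∑' m : ℕ, f (j, m) =
      if j = 0 then (0 : ℂ) else ∑ m ∈ Finset.range (j + 1), C j m * U ^ (j - m) * z ^ m := by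
    intro j
    rw [tsum_eq_sum (s := Finset.range (j + 1)) (fun m hm => by
      have : ¬ m ≤ j := fun h => hm (Finset.mem_range.mpr (Nat.lt_succ_of_le h))
      simp only [hf]
      rw [if_neg (fun h => this h.2)])]
    by_cases hj : j = 0
    · subst hj
      rw [if_pos rfl]
      refine Finset.sum_eq_zero fun m _ => ?_
      simp only [hf]
      rw [if_neg (fun h => by omega)]
    · rw [if_neg hj]
      refine Finset.sum_congr rfl fun m hm => ?_
      have hmj : m ≤ j := Nat.lt_succ_iff.mp (Finset.mem_range.mp hm)
      simp only [hf]
      rw [if_pos ⟨Nat.one_le_iff_ne_zero.mpr hj, hmj⟩]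
  -- columns of `f`: `a_m(U) z^m`
  have hcolf : ∀ m : ℕ, ∑' j : ℕ, f (j, m) =
      (∑' j : ℕ, (if 1 ≤ j ∧ m ≤ j then C j m * U ^ (j - m) else 0)) * z ^ m := by
    intro m
    rw [← tsum_mul_right]
    refine tsum_congr fun j => ?_
    simp only [hf]
    split_ifs <;> ring
  -- Fubini
  calc (∑' j : ℕ, (if j = 0 then (0 : ℂ) else ∑ m ∈ Finset.range (j + 1), C j m * U ^ (j - m) * z ^ m))
      = ∑' j : ℕ, ∑' m : ℕ, f (j, m) := tsum_congr fun j => (hrowf j).symm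
    _ = ∑' p : ℕ × ℕ, f p := (hfsum.tsum_prod).symm
    _ = ∑' q : ℕ × ℕ, f (Equiv.prodComm ℕ ℕ q) := (Equiv.tsum_eq (Equiv.prodComm ℕ ℕ) f).symm
    _ = ∑' m : ℕ, ∑' j : ℕ, f (j, m) := by
        have hs : Summable fun q : ℕ × ℕ => f q.swap := hfsum.prod_symm
        exact hs.tsum_prod
    _ = _ := tsum_congr fun m => hcolf m

end Rearrangement

/-! ### The sourced torus: `Z_L(U,h) = Z₀'(L) exp(Σ_m a_m(L;U) h^m)` -/

section Model

variable (β μ : ℝ)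

/-- **The sourced pressure as a power series in the source (fixed temperature).** For `β ≥ 0`, `μ` there are
`δ > 0`, `ϱ > 0` with `ϱδ ≤ 1/3` and `A ≥ 0` such that for every `L ≥ 3` there are a positive real `Z₀'(L)`
and coefficients `a_m(L;U) ∈ ℂ` (`U` real, `|U| ≤ δ`) with
(i) `‖a_m(L;U)‖ ≤ (3/2) L² A ϱ^m`; (ii) `‖a_m(L;U) - a_m(L;0)‖ ≤ (3/2) L² A ϱ^{m+1} |U|`;
(iii) for all real `|U|, |h| ≤ δ`: `Σ_m ‖a_m(L;U) h^m‖ < ∞` and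
`Tr e^{-β dWaveSourceTorus L U μ h} = Z₀'(L) · exp(Σ_m a_m(L;U) h^m)`.
(`a_m(L;U) = Σ_{j≥max(m,1)} C_{j,m}(L) U^{j-m}` with the restricted coefficients of
`DWaveSourceTorusJointExpansion`; `Z₀'(L) = e^{βμL²} Tr e^{-β dΓ(𝓚₀)}`.) [cite: BenfattoGiulianiMastropietro2006, (2.77)] -/
theorem dWaveSourceTorus_partitionFn_eq_exp_sourcePowerSeries (hβ : 0 ≤ β) :
    ∃ δ : ℝ, 0 < δ ∧ ∃ ϱ : ℝ, 0 < ϱ ∧ ϱ * δ ≤ 1 / 3 ∧ ∃ A : ℝ, 0 ≤ A ∧ ∀ (L : ℕ) [NeZero L], 3 ≤ L →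
      ∃ Z₀ : ℝ, 0 < Z₀ ∧ ∃ a : ℝ → ℕ → ℂ,
        (∀ U : ℝ, |U| ≤ δ → ∀ m : ℕ, ‖a U m‖ ≤ 3 / 2 * ((L : ℝ) ^ 2 * A) * ϱ ^ m) ∧
        (∀ U : ℝ, |U| ≤ δ → ∀ m : ℕ, ‖a U m - a 0 m‖ ≤ 3 / 2 * ((L : ℝ) ^ 2 * A) * ϱ ^ (m + 1) * |U|) ∧
        ∀ U h : ℝ, |U| ≤ δ → |h| ≤ δ →
          (Summable fun m : ℕ => ‖a U m * (h : ℂ) ^ m‖) ∧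
          Matrix.partitionFn β (dWaveSourceTorus L U μ h) =
            (Z₀ : ℂ) * Complex.exp (∑' m : ℕ, a U m * (h : ℂ) ^ m) := by
  classical
  obtain ⟨δ, hδ, ϱ, hϱ, hϱδ, A, hA, hmain⟩ := dWaveSourceTorus_partitionFn_eq_exp_doubleSeries β μ hβ
  refine ⟨δ, hδ, ϱ, hϱ, hϱδ, A, hA, ?_⟩
  intro L _ hL
  obtain ⟨hC, hUh⟩ := hmain L hL
  haveI : Nonempty (Finset (Orb (FermionTorus 2 L))) := ⟨∅⟩
  -- the free operator and the restricted coefficients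
  set K0 := shibaOneBody (dwsHopping L) (dwsPairing L 0) μ ((0 : ℝ) : ℂ) with hK0
  have hK0h : K0.IsHermitian := by
    refine isHermitian_shibaOneBody (fun x y => ?_) _ μ 0
    simp only [dwsHopping, apply_ite star, star_neg, star_one, star_zero, (fermionTorusGraph 2 L).adj_comm x y]
  set Cf : ℕ → ℕ → ℂ := fun j m => orderedIntegral j (fun u : Fin j → ℝ => (-(β : ℂ)) ^ j *
      ∑ g ∈ univ.filter (fun g : Fin j → DwsType × FermionTorus 2 L =>
          (univ.filter fun i => Sum.isRight (g i).1).card = m),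
        (∏ i, dwsWeight L 1 1 (g i)) *
          ursellOf (FermionicTree.moment (wordCluster 2 j)
            (wordPropMatrix β K0 (dwsOp L) (dwsOm L) g (fun i => ((u i : ℝ) : ℂ) * -(β : ℂ)))) univ) 1
    with hCf
  set B : ℝ := (L : ℝ) ^ 2 * A with hB
  have hB0 : 0 ≤ B := by positivity
  have hCfb : ∀ j m : ℕ, 1 ≤ j → ‖Cf j m‖ ≤ B * ϱ ^ j := fun j m hj => hC j m hj
  -- the free partition function, a positive real
  have hZ0pos : 0 < Matrix.partitionFn β (dGamma K0) := Matrix.partitionFn_pos β (isHermitian_dGamma hK0h)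
  set Z₀ : ℝ := Real.exp (β * (μ * (L : ℝ) ^ 2)) * (Matrix.partitionFn β (dGamma K0)).re with hZ₀
  have hZ₀pos : 0 < Z₀ := mul_pos (Real.exp_pos _) (Complex.pos_iff.mp hZ0pos).1
  have hZ₀c : (Z₀ : ℂ) = (Real.exp (β * (μ * (L : ℝ) ^ 2)) : ℂ) * Matrix.partitionFn β (dGamma K0) := by
    have him : (Matrix.partitionFn β (dGamma K0)).im = 0 := (Complex.pos_iff.mp hZ0pos).2.symm
    rw [hZ₀, Complex.ofReal_mul]
    congr 1
    exact Complex.ext (by simp) (by simp [him])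
  -- the source coefficients
  set a : ℝ → ℕ → ℂ := fun U m => ∑' j : ℕ, (if 1 ≤ j ∧ m ≤ j then Cf j m * (U : ℂ) ^ (j - m) else 0)
    with ha
  have hnormU : ∀ {U : ℝ}, |U| ≤ δ → ‖(U : ℂ)‖ ≤ δ := fun hU => by
    rw [Complex.norm_real, Real.norm_eq_abs]; exact hU
  refine ⟨Z₀, hZ₀pos, a, fun U hU m => ?_, fun U hU m => ?_, fun U h hU hh => ?_⟩
  · -- (i)
    exact (norm_sourceCoeff_le hB0 hϱ.le hδ.le hϱδ hCfb (hnormU hU) m).2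
  · -- (ii)
    have key := norm_sourceCoeff_sub_le hB0 hϱ.le hδ.le hϱδ hCfb (hnormU hU) m
    simp only [ha, Complex.ofReal_zero]
    rw [Complex.norm_real, Real.norm_eq_abs] at key
    exact key
  · -- (iii)
    obtain ⟨hrep, -, hZ⟩ := hUh U h hU hh
    obtain ⟨hAbs, hrearr⟩ := tsum_connected_eq_tsum_sourceCoeff_mul_pow hB0 hϱ.le hδ.le hϱδ hCfb
      (hnormU hU) (hnormU hh)
    refine ⟨hAbs, ?_⟩
    -- the connected series equals the rearranged source series
    have hconn : (∑' j : ℕ, (if j = 0 then (0 : ℂ) else orderedIntegral j (wordUrsellIntegrand β K0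
        (dwsOp L) (dwsOm L) (dwsWeight L U h) j) 1)) = ∑' m : ℕ, a U m * (h : ℂ) ^ m := by
      rw [← hrearr]
      refine tsum_congr fun j => ?_
      by_cases hj : j = 0
      · rw [if_pos hj, if_pos hj]
      · rw [if_neg hj, if_neg hj, hrep j]
    -- (the two sides elaborate `DecidableEq (Orb _)` through different instance paths; `convert` closes them)
    have key := hZ
    rw [hconn] at key
    rw [hZ₀c]
    convert key using 6

end Model

end Literature.MathematicalPhysics.QuantumLattice
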